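import Summits.BirchSwinnertonDyer.BirchSwinnertonDyer.Theorems.PrintCf2RamifiedOffTYZSelmerRankOneMover
import Summits.BirchSwinnertonDyer.BirchSwinnertonDyer.Theorems.PrintCf2RamifiedOffTYZMoverSumBlocksOdd
import Summits.BirchSwinnertonDyer.BirchSwinnertonDyer.Theorems.PrintCf2RamifiedOffTYZQFormIdentitySeven
import Summits.BirchSwinnertonDyer.BirchSwinnertonDyer.Theorems.PrintCf2RamifiedOffTYZMoverKummerBits
import HarnessLib

/-!
# Crux `PrintCf2.RamifiedOffTYZOfFacts` (stmt-BirchSwinnertonDyer-20509), line `offtyz-v7`, LEAD cycle 9 (cruxlead-20509 g8):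
# THE `s = 1` STRATUM OF THE RESIDUAL FOR `n ≡ 7 (mod 8)` — a Galois mover of the genus point EXISTS whenever `#Sel₂(E_n) = 8` and
# Monsky's kernel class is NON-DEGENERATE (`q(κ_n) ≠ 0`), hence (door p672160) `ord_{s=1} L(E_n,s) = rank E_n(ℚ) = 1`, `Ш(E_n)[2^∞] = 0`, `BSD(E_n, 2)`

THEOREMS ONLY (no `def`, no named fact, no `sorry`), `--supports stmt-BirchSwinnertonDyer-20509` (the `s = 1`, `n ≡ 7 (8)` stratum of item
23432 `RamifiedOffJumpOneOfFacts`; the `n ≡ 7` counterpart of the LEAD g7's `…SelmerRankOneMover` (p691170), made possible by THIS seat's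
(★)₇ `QFormForest.qFormIdentityOmega_seven`).

THE ASSEMBLY (`exists_sq_mover_of_card_selmer_eight_seven`).  `n = p₁⋯p_k ≡ 7 (mod 8)` square-free.  By `…MoverSumBlocksOdd` (g7, p695107), for every
automorphism `g` of `ℍ′_n`: `g*g` moves `P(n)` iff `Σ_{S adm} w_S·(1 + [g moves i] + Σ_{i∈S} xᵢ)·(ρ(N_S)·x) = 1`.  At `g ∈ Gal(ℍ′_n/K_n)` with prime bits
`x = eᵢ` the sum is `Ω_{ii} = κB_i` and with `x = eᵢ + e_j` it is `Ω_{ij} + Ω_{ji} = (κA+κB)_i + (κA+κB)_j` ((★)₇).  DIFFERENCES from `n ≡ 5`: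
(1) non-degeneracy is NOT automatic (for `n ≡ 7` the Selmer class can be of type `(n; 1)` / `(1; 1)`, e.g. `n` prime: then `q(κ_n) = 0` and NO square
moves `P(n)` — consistent, that case is TYZ's own `H′_n = H_n` family) — it is the HYPOTHESIS `hnd : κB ≠ 0 ∨ κA non-constant` (= g5's `q(κ_n) ≠ 0`,
crux note `Lines/offtyz_v7_QForm.md` §6 (6c)); (2) the bit vectors are realised by THIS seat's `…MoverKummerBits.exists_mem_galK_bits_eq_of_prod` — surjectivity of
`Gal(ℍ′_n/K_n) → Gal(L_n(i)/K_n) ≅ 𝔽₂^k` on the prime bits (`[g moves i·√−pⱼ]`) from Galois theory alone (for `n ≡ 5` g7 used the conductor-2 ring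
class dictionary of the block `d = n` and Gauss's count; for `n ≡ 7` the full block carries no such dictionary in the typed displays).
OTHER HYPOTHESES as in g7's file (all printed statements): the genus-point data `D` with `recursion`, `thm35Main`, `scriptLSpec`, `lemma318`; the
CM-point layer and the conductor-2 ring class dictionary on every block `d ≡ 5 (mod 8)`; the Frobenius clause on every block `d ≡ 5 (mod 8)`;
TYZ Thm 1.1 (`thm11_parity_of_scriptL`, for the cofactor parities, cofactors `≡ 3 (mod 8)` via Smith row 3).
BSD is not proved by any of this; no class is closed by this file (a conditional result toward item 23432).

References: [cite: TianYuanZhang2017, Thm. 1.1, §3.1 (p0011 L1–L73), Prop. 3.2 (1), Thm. 3.5, Thm. 3.6 (1), Lemma 3.18, proof of Lemma 3.21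
(p0020 L27–L63)]; [cite: HeathBrown1994SelmerCongruentII, Appendix (Monsky), typescript p. 39 L10–L41]; [cite: Smith2016CongruentDensity, Thm. 1.2,
Thm. 1.4]; [cite: Cox2013, §5.C Lemma 5.19, §7.D Thm. 7.24, §9.A]; crux notes `Lines/offtyz_v7_QForm.md` §6, `Lines/offtyz_v7_MoverAssembly.md` §6.
-/

noncomputable section

open scoped Classical NumberField

open WeierstrassCurve WeierstrassCurve.Affine Finset Matrix Literature.NumberTheory.EllipticCurves
  Literature.NumberTheory.EllipticCurves.TianYuanZhang2017
  Literature.NumberTheory.EllipticCurves.TianYuanZhang2017.W2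
  Literature.NumberTheory.EllipticCurves.HeathBrown1994
  Literature.NumberTheory.EllipticCurves.Smith2016
  Literature.NumberTheory.QuadraticFields.RingClass
  Literature.NumberTheory.QuadraticFields
  Summit.BirchSwinnertonDyer.Rank1Residual.P2.GenusPeriodTransferLayer
  Summit.BirchSwinnertonDyer.PrintCf2.QForm
  Summit.BirchSwinnertonDyer.PrintCf2.QFormForest

set_option autoImplicit false

namespace Summit.BirchSwinnertonDyer.PrintCf2.MoverAssembly

variable {k : ℕ} (p : Fin k → ℕ) (hp : ∀ i, (p i).Prime) (hodd : ∀ i, Odd (p i)) (hinj : Function.Injective p)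
variable {n : ℕ} (D : GenusPointData n)

/-! ## §1 Existence of the mover for `n ≡ 7 (mod 8)` -/

include hp hodd hinj in
/-- **A SQUARE MOVER OF `P(n)` EXISTS WHEN `#Sel₂(E_n) = 8` AND MONSKY'S KERNEL CLASS IS NON-DEGENERATE** (`n = p₁⋯p_k ≡ 7 (mod 8)` square-free;
hypotheses: the printed recursion and sign choices of `𝓛`, the CM-point / ring-class displays with ONE complex conjugation, the Frobenius clause on
every block `d ≡ 5 (mod 8)`, TYZ Thm 1.1, and `hnd : κB ≠ 0 ∨ κA non-constant`).
There is `g ∈ Gal(ℍ′_n/K_n)` with `g*g·P(n) ≠ P(n)`.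
[cite: TianYuanZhang2017, §3.1 (p0011 L53–L73), Prop. 3.2 (1), Thm. 3.6 (1), proof of Lemma 3.21 (p0020 L27–L63), Thm. 1.1]
[cite: HeathBrown1994SelmerCongruentII, Appendix (Monsky), typescript p. 39 L10–L41] [cite: Smith2016CongruentDensity, Thm. 1.2 rows 1, 3] -/
theorem exists_sq_mover_of_card_selmer_eight_seven (hn : n = ∏ i, p i) (h7 : n % 8 = 7) (hrec : D.recursion) (hLs : D.scriptLSpec)
    (z : ℕ → APoint D.H) (Φ : ℕ → Finset (D.H ≃ₐ[ℚ] D.H)) (ΓH ΓH' : ℕ → Subgroup (D.H ≃ₐ[ℚ] D.H))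
    (σ : ℕ → (D.H ≃ₐ[ℚ] D.H)) (c : D.H ≃ₐ[ℚ] D.H) (ρ : (d : ℕ) → (D.galK d →* RingClassGroup (GenusField d) 2))
    (hc : D.ConjSpec c)
    (hblock : ∀ d ∈ n.divisors, ((d % 8 = 5 ∨ d % 8 = 6) → D.CMBlockSpec d (z d) (Φ d) (ΓH d) (ΓH' d) (σ d) c) ∧
      (d % 8 = 7 → D.SevenBlockSpec d))
    (hring : ∀ d ∈ n.divisors, d % 8 = 5 → D.RingClassTwoBlockSpec d (ΓH d) (ΓH' d) (ρ d))
    (hFrob : ∀ d ∈ n.divisors, d % 8 = 5 → ∀ q : ℕ, q.Prime → q ∣ d → ∃ φ : D.H ≃ₐ[ℚ] D.H,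
      φ (D.sqrtNeg d) = D.sqrtNeg d ∧ φ * φ ∈ ΓH' d ∧ φ D.im = (jacobiSym (-1) q) • D.im ∧
        ∀ r : ℕ, r.Prime → r ∣ n → r ≠ q → φ (D.sqrtNeg r) = (jacobiSym (-(r : ℤ)) q) • D.sqrtNeg r)
    (h11 : thm11_parity_of_scriptL)
    (hnd : kappaB p ≠ 0 ∨ ∃ i j, kappaA p i ≠ kappaA p j) :
    ∃ g : D.H ≃ₐ[ℚ] D.H, g (D.sqrtNeg n) = D.sqrtNeg n ∧ D.galPt (g * g) (D.P n) ≠ D.P n := by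
  have hsq : Squarefree n := by rw [hn]; exact squarefree_prod_of_injective p hp hinj
  have hn0 : n ≠ 0 := hsq.ne_zero
  have hnn : n ∈ n.divisors := Nat.mem_divisors_self n hn0
  have hprod : ∏ i, p i = n := hn.symm
  have h7' : (∏ i, p i) % 8 = 7 := by rw [hprod]; exact h7
  obtain ⟨hdiag, hoff⟩ := qFormIdentityOmega_seven k p hp hodd hinj h7'
  -- bit surjectivity on `Gal(ℍ′_n/K_n)` (Galois theory, `…MoverKummerBits`)
  have hbits : ∀ v : Fin k → ZMod 2, ∃ g : D.H ≃ₐ[ℚ] D.H, g (D.sqrtNeg n) = D.sqrtNeg n ∧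
      ∀ j, (if g (D.im * D.sqrtNeg (p j)) = D.im * D.sqrtNeg (p j) then (0 : ZMod 2) else 1) = v j :=
    fun v => exists_mem_galK_bits_eq_of_prod D p hp hinj (fun j => mem_divisors_of_block p hnn hprod j) hnn hprod v
  -- the block-sum criterion for an arbitrary `g`
  have hcrit := fun g =>
    sqMover_iff_sum_blocks_odd p hp hodd hinj D hn (Or.inr h7) hrec hLs z Φ ΓH ΓH' σ c ρ hc hblock hring hFrob h11 g
  -- the bit of `i` for `g ∈ Gal(ℍ′_n/K_n)` is the sum of the prime bits
  have him : ∀ g : D.H ≃ₐ[ℚ] D.H, g (D.sqrtNeg n) = D.sqrtNeg n →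
      (if g D.im = D.im then (0 : ZMod 2) else 1) =
        ∑ l, (if g (D.im * D.sqrtNeg (p l)) = D.im * D.sqrtNeg (p l) then (0 : ZMod 2) else 1) := by
    intro g hg
    have h := bit_sqrtNeg_eq_bit_im_add_sum D p hnn hprod g
    rw [if_pos hg] at h
    have e : ∀ a b : ZMod 2, 0 = a + b → a = b := by decide
    exact e _ _ h
  by_cases hB : kappaB p = 0
  · -- `κB = 0`, so `κA_i ≠ κA_j` for some `i ≠ j`: test vector `eᵢ + e_j`
    obtain ⟨i, j, hA⟩ : ∃ i j, kappaA p i ≠ kappaA p j := hnd.resolve_left (not_not.mpr hB)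
    have hij : i ≠ j := fun h => hA (by rw [h])
    obtain ⟨g, hg, hgbits⟩ := hbits (fun l => (if l = i then 1 else 0) + (if l = j then 1 else 0))
    refine ⟨g, hg, (hcrit g).mpr ?_⟩
    rw [sum_blocks_pair_eq_omega p hij _ _ ?_ hgbits, hoff i j hij]
    · have hB0 : ∀ l, kappaB p l = 0 := fun l => congr_fun hB l
      rw [hB0 i, hB0 j, add_zero, add_zero]
      rcases (by decide : ∀ x : ZMod 2, x = 0 ∨ x = 1) (kappaA p i) with h | h <;>
        rcases (by decide : ∀ x : ZMod 2, x = 0 ∨ x = 1) (kappaA p j) with h' | h'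
      · exact absurd (h.trans h'.symm) hA
      · rw [h, h']; decide
      · rw [h, h']; decide
      · exact absurd (h.trans h'.symm) hA
    · rw [him g hg]
      simp only [hgbits]
      rw [Finset.sum_add_distrib, Finset.sum_ite_eq' univ i, if_pos (mem_univ i), Finset.sum_ite_eq' univ j, if_pos (mem_univ j)]
      decide
  · -- some `κB_i = 1`: test vector `eᵢ`
    obtain ⟨i, hi⟩ : ∃ i, kappaB p i ≠ 0 := by
      by_contra h; push Not at h; exact hB (funext h)
    have hi1 : kappaB p i = 1 := by
      rcases (by decide : ∀ x : ZMod 2, x = 0 ∨ x = 1) (kappaB p i) with h | h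
      · exact absurd h hi
      · exact h
    obtain ⟨g, hg, hgbits⟩ := hbits (fun l => if l = i then 1 else 0)
    refine ⟨g, hg, (hcrit g).mpr ?_⟩
    rw [sum_blocks_single_eq_omega p i _ _ ?_ hgbits, hdiag i, hi1]
    rw [him g hg]
    simp only [hgbits]
    rw [Finset.sum_ite_eq' univ i, if_pos (mem_univ i)]

/-! ## §2 Through the Galois-mover door -/

include hp hodd hinj in
/-- **THE `s = 1` STRATUM FOR `n ≡ 7 (mod 8)`, THROUGH THE DOOR.**  For `n = p₁⋯p_k ≡ 7 (mod 8)` square-free with `#Sel⁽²⁾(E_n/ℚ) = 8` and Monsky's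
kernel class non-degenerate (`κB ≠ 0` or `κA` non-constant, i.e. `q(κ_n) ≠ 0`), granted the printed Tian–Yuan–Zhang §3 data on `n` (genus-point
displays `recursion`, `thm35Main`, `scriptLSpec`, `lemma318`; the CM-point layer and the conductor-`2` ring class dictionary on every block; the
Frobenius clause on every block `d ≡ 5 (mod 8)`) and Thm 1.1:
`ord_{s=1} L(E_n, s) = 1`, `rank E_n(ℚ) = 1`, `Ш(E_n/ℚ)[2^∞] = 0`, and `BSD(E_n, 2)` holds.
[cite: TianYuanZhang2017, Thm. 1.1, §3.1, Prop. 3.2 (1), Thm. 3.5, Thm. 3.6 (1), Lemma 3.18, proof of Lemma 3.21]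
[cite: HeathBrown1994SelmerCongruentII, Appendix (Monsky), typescript p. 39 L10–L41] [cite: Smith2016CongruentDensity, Thm. 1.2] [cite: Miller2011LMS, Def. 1.1] -/
theorem rankOne_sha_bsdp_two_of_card_selmer_eight_seven (hn : n = ∏ i, p i) (h7 : n % 8 = 7)
    (hrec : D.recursion) (h35 : D.thm35Main) (hLs : D.scriptLSpec) (h318 : D.lemma318)
    (z : ℕ → APoint D.H) (Φ : ℕ → Finset (D.H ≃ₐ[ℚ] D.H)) (ΓH ΓH' : ℕ → Subgroup (D.H ≃ₐ[ℚ] D.H))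
    (σ : ℕ → (D.H ≃ₐ[ℚ] D.H)) (c : D.H ≃ₐ[ℚ] D.H) (ρ : (d : ℕ) → (D.galK d →* RingClassGroup (GenusField d) 2))
    (hc : D.ConjSpec c)
    (hblock : ∀ d ∈ n.divisors, ((d % 8 = 5 ∨ d % 8 = 6) → D.CMBlockSpec d (z d) (Φ d) (ΓH d) (ΓH' d) (σ d) c) ∧
      (d % 8 = 7 → D.SevenBlockSpec d))
    (hring : ∀ d ∈ n.divisors, d % 8 = 5 → D.RingClassTwoBlockSpec d (ΓH d) (ΓH' d) (ρ d))
    (hFrob : ∀ d ∈ n.divisors, d % 8 = 5 → ∀ q : ℕ, q.Prime → q ∣ d → ∃ φ : D.H ≃ₐ[ℚ] D.H,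
      φ (D.sqrtNeg d) = D.sqrtNeg d ∧ φ * φ ∈ ΓH' d ∧ φ D.im = (jacobiSym (-1) q) • D.im ∧
        ∀ r : ℕ, r.Prime → r ∣ n → r ≠ q → φ (D.sqrtNeg r) = (jacobiSym (-(r : ℤ)) q) • D.sqrtNeg r)
    (h11 : thm11_parity_of_scriptL)
    (hnd : kappaB p ≠ 0 ∨ ∃ i j, kappaA p i ≠ kappaA p j)
    (hsel : haveI := isElliptic_congruentNumberCurve (show n ≠ 0 by rw [hn]; exact (squarefree_prod_of_injective p hp hinj).ne_zero);
      Nat.card ((congruentNumberCurve n).selmerGroup 2) = 8) :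
    haveI := isElliptic_congruentNumberCurve (show n ≠ 0 by rw [hn]; exact (squarefree_prod_of_injective p hp hinj).ne_zero)
    (congruentNumberCurve n).analyticRank = 1 ∧ (congruentNumberCurve n).mordellWeilRank = 1 ∧
      AddCommGroup.primaryComponent (congruentNumberCurve n).sha 2 = ⊥ ∧
      BSDp (congruentNumberCurve n) 2 := by
  have hsq : Squarefree n := by rw [hn]; exact squarefree_prod_of_injective p hp hinj
  obtain ⟨g, -, hmove⟩ := exists_sq_mover_of_card_selmer_eight_seven p hp hodd hinj D hn h7 hrec hLs z Φ ΓH ΓH' σ c ρ hc hblock hring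
    hFrob h11 hnd
  exact GaloisMotion.rankOne_sha_bsdp_two_congruentNumberCurve_of_selmerEight_of_mover hsq (Or.inr h7) hsel D h35 hLs h318 (g * g)
    (mul_self_apply_im D g) (fun d hd => mul_self_apply_sqrtNeg D g hd) hmove

end Summit.BirchSwinnertonDyer.PrintCf2.MoverAssembly

end
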